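import Summits.Ventures.PercRepro.C026HubPairRot

/-!
# Hub-pair graphs, IV: the decoder inverts the rotation (p5, gen 11)

**`dec_psi`**: on a supported graph, `dec (psi ω) = ω` for every configuration `ω` whose rows satisfy
(i) the abstract decoder recovers the rotated set from the image rows (`hrot`), (ii) the source is
*determined* on the touched classes (`hdet1`: a rotated vertex has no closed `c`-edge and no open
`a`- or `b`-edge; `hdet2`: a cut pair is all-open when the unrotated partner has a closed `c`-edge and
all-closed otherwise).  Both are Boolean facts about the rows alone, checked for every `KL` state of the
model in `C026HubPairCheck.lean`.
-/

namespace PercRepro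

namespace PairModel

/-- A rotated vertex is a non-mark. -/
theorem nonMark_of_rot {n : ℕ} {O C : Rows} {i : ℕ} (h : rot n O C i = true) :
    nonMark i = true := by
  unfold rot rot0 at h
  simp only [Bool.or_eq_true, Bool.and_eq_true] at h
  rcases h with ⟨⟨h, _⟩, _⟩ | ⟨⟨⟨h, _⟩, _⟩, _⟩ <;> exact h

/-- Non-marks are `≥ 3`. -/
theorem three_le_of_nonMark {i : ℕ} (h : nonMark i = true) : 3 ≤ i := by
  simpa [nonMark] using h

/-- The mark `2` is not a non-mark. -/
theorem nonMark_two : nonMark 2 = false := by decide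

/-- `opnA` implies rotated. -/
theorem rot_of_opnA {n : ℕ} {O C : Rows} {q : ℕ} (h : opnA n O C q = true) : rot n O C q = true := by
  unfold opnA at h
  simp only [Bool.and_eq_true] at h
  exact h.1.1

/-- `opnB` implies rotated. -/
theorem rot_of_opnB {n : ℕ} {O C : Rows} {q : ℕ} (h : opnB n O C q = true) : rot n O C q = true := by
  unfold opnB at h
  simp only [Bool.and_eq_true] at h
  exact h.1.1.1

/-- The `c`-class of an unrotated non-mark is untouched (closed rows). -/
theorem adj_imgC_two_of_not_rot {n : ℕ} (O C : Rows) (hn : 2 < n) {q : ℕ} (hq : q < n)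
    (hnm : nonMark q = true) (hr : rot n O C q = false) :
    adj (imgC n O C) q 2 = adj C q 2 := by
  have h3 : 3 ≤ q := three_le_of_nonMark hnm
  have hmin : min q 2 = 2 := by omega
  have hmax : max q 2 = q := by omega
  rw [adj_imgC O C hq 2, hmin, hmax]
  have hc : cCond n O C 2 q = false := by simp [cCond, hr]
  have hcut : cutCond n O C 2 q = false := by simp [cutCond, nonMark]
  have hopn : opnCond n O C 2 q = false := by simp [opnCond]
  have hq2 : q ≠ 2 := by omega
  simp [hc, hcut, hopn, hn, hq2]

end PairModel

namespace MultiGraph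

open PairModel

variable {V E : Type*} {G : MultiGraph V E} {ι : ℕ → V} {n : ℕ}

/-- The closed rows are symmetric. -/
theorem adj_cRows_symm (ω : Config E) {i j : ℕ} (hi : i < n) (hj : j < n) :
    adj (G.cRows ι n ω) i j = adj (G.cRows ι n ω) j i := by
  apply Bool.eq_iff_iff.mpr
  rw [adj_cRows ω hi j, adj_cRows ω hj i]
  constructor
  · rintro ⟨_, hij, e, he, h⟩
    exact ⟨hi, Ne.symm hij, e, he, h.symm⟩
  · rintro ⟨_, hij, e, he, h⟩
    exact ⟨hj, Ne.symm hij, e, he, h.symm⟩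

/-- The open rows are symmetric. -/
theorem adj_oRows_symm (ω : Config E) {i j : ℕ} (hi : i < n) (hj : j < n) :
    adj (G.oRows ι n ω) i j = adj (G.oRows ι n ω) j i := by
  apply Bool.eq_iff_iff.mpr
  rw [adj_oRows ω hi j, adj_oRows ω hj i]
  constructor
  · rintro ⟨_, hij, e, he, h⟩
    exact ⟨hi, Ne.symm hij, e, he, h.symm⟩
  · rintro ⟨_, hij, e, he, h⟩
    exact ⟨hj, Ne.symm hij, e, he, h.symm⟩

/-- No closed copy in a class: every edge of the class is open. -/
theorem eq_true_of_adj_cRows_eq_false {ω : Config E} {i j : ℕ} (hi : i < n) (hj : j < n)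
    (hij : i ≠ j) (h : adj (G.cRows ι n ω) i j = false) {e : E} (he : G.Joins e (ι i) (ι j)) :
    ω e = true := by
  cases hω : ω e
  · exact absurd ((adj_cRows ω hi j).2 ⟨hj, hij, e, hω, he⟩) (by simp [h])
  · rfl

/-- No open copy in a class: every edge of the class is closed. -/
theorem eq_false_of_adj_oRows_eq_false {ω : Config E} {i j : ℕ} (hi : i < n) (hj : j < n)
    (hij : i ≠ j) (h : adj (G.oRows ι n ω) i j = false) {e : E} (he : G.Joins e (ι i) (ι j)) :
    ω e = false := by
  cases hω : ω e
  · rfl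
  · exact absurd ((adj_oRows ω hi j).2 ⟨hj, hij, e, hω, he⟩) (by simp [h])

/-- **The decoder inverts the rotation** under the abstract hypotheses on the rows of `ω`. -/
theorem dec_psi (hsup : G.Supported ι n) (hinj : InjBelow ι n) (hn : 2 < n) {ω : Config E}
    (hrot : ∀ i < n, rotD' n (imgO n (G.oRows ι n ω) (G.cRows ι n ω))
      (imgC n (G.oRows ι n ω) (G.cRows ι n ω)) i = rot n (G.oRows ι n ω) (G.cRows ι n ω) i)
    (hdet1 : ∀ i < n, rot n (G.oRows ι n ω) (G.cRows ι n ω) i = true →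
      adj (G.cRows ι n ω) i 2 = false ∧ adj (G.oRows ι n ω) i 0 = false ∧
        adj (G.oRows ι n ω) i 1 = false)
    (hdet2 : ∀ p < n, ∀ q < n, nonMark p = true → nonMark q = true → p ≠ q →
      rot n (G.oRows ι n ω) (G.cRows ι n ω) p = true →
      rot n (G.oRows ι n ω) (G.cRows ι n ω) q = false →
        (adj (G.cRows ι n ω) q 2 = true → adj (G.cRows ι n ω) p q = false) ∧
          (adj (G.cRows ι n ω) q 2 = false → adj (G.oRows ι n ω) p q = false)) :
    G.dec ι n (G.psi ι n ω) = ω := by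
  set O := G.oRows ι n ω with hO
  set C := G.cRows ι n ω with hC
  funext e
  obtain ⟨i, hi, j, hj, hij⟩ := exists_joins hsup e
  -- the ordered class `(p, q)`
  obtain ⟨p, q, hp, hq, hpq, he⟩ : ∃ p q, p < n ∧ q < n ∧ p ≤ q ∧ G.Joins e (ι p) (ι q) := by
    rcases le_total i j with h | h
    · exact ⟨i, j, hi, hj, h, hij⟩
    · exact ⟨j, i, hj, hi, h, hij.symm⟩
  have hmin : min p q = p := min_eq_left hpq
  have hmax : max p q = q := max_eq_right hpq
  rw [dec_apply_of_joins hinj hp hq he, hmin, hmax, oRows_psi hinj, cRows_psi hinj,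
    psi_apply_of_joins hinj hp hq he, hmin, hmax]
  rw [← hO, ← hC]
  have hrp := hrot p hp
  have hrq := hrot q hq
  unfold ruleD ruleO
  rw [hrp, hrq]
  -- case (α): a `c`-edge at a rotated vertex
  by_cases h1 : ((p == 2) && rot n O C q) = true
  · rw [if_pos h1]
    have h1' := h1
    simp only [Bool.and_eq_true, beq_iff_eq] at h1'
    obtain ⟨rfl, hrq'⟩ := h1'
    have hq3 := three_le_of_nonMark (nonMark_of_rot hrq')
    have hcq := (hdet1 q hq hrq').1
    exact (eq_true_of_adj_cRows_eq_false hq hn (by omega) hcq he.symm).symm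
  rw [if_neg h1]
  have hc1 : cCond n O C p q = false := by
    simpa [cCond] using h1
  -- case (β): the cut
  by_cases h2 : (nonMark p && (p != q) && (rot n O C p != rot n O C q)) = true
  · rw [if_pos h2]
    simp only [Bool.and_eq_true, bne_iff_ne, ne_eq] at h2
    obtain ⟨⟨hnp, hpq'⟩, hne⟩ := h2
    have hp3 := three_le_of_nonMark hnp
    have hnq : nonMark q = true := by simp [nonMark]; omega
    cases hrp' : rot n O C p
    · -- `q` rotated, `p` not
      have hrq' : rot n O C q = true := by
        cases h : rot n O C q
        · exact absurd (hrp'.trans h.symm) hne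
        · rfl
      rw [if_neg (by simp), adj_imgC_two_of_not_rot O C hn hp hnp hrp']
      obtain ⟨hA, hB⟩ := hdet2 q hq p hp hnq hnp (Ne.symm hpq') hrq' hrp'
      cases hcp : adj C p 2
      · have := hB hcp
        rw [adj_oRows_symm ω hq hp] at this
        exact (eq_false_of_adj_oRows_eq_false hp hq hpq' this he).symm
      · have := hA hcp
        rw [adj_cRows_symm ω hq hp] at this
        exact (eq_true_of_adj_cRows_eq_false hp hq hpq' this he).symm
    · -- `p` rotated, `q` not
      have hrq' : rot n O C q = false := by
        cases h : rot n O C q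
        · rfl
        · exact absurd (hrp'.trans h.symm) hne
      rw [if_pos rfl, adj_imgC_two_of_not_rot O C hn hq hnq hrq']
      obtain ⟨hA, hB⟩ := hdet2 p hp q hq hnp hnq hpq' hrp' hrq'
      cases hcq : adj C q 2
      · exact (eq_false_of_adj_oRows_eq_false hp hq hpq' (hB hcq) he).symm
      · exact (eq_true_of_adj_cRows_eq_false hp hq hpq' (hA hcq) he).symm
  rw [if_neg h2]
  have hc2 : cutCond n O C p q = false := by
    simpa [cutCond] using h2
  -- case (γ): the mark edges at a rotated vertex
  by_cases h3 : (((p == 0) || (p == 1)) && rot n O C q) = true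
  · rw [if_pos h3]
    simp only [Bool.and_eq_true, Bool.or_eq_true, beq_iff_eq] at h3
    obtain ⟨hp01, hrq'⟩ := h3
    have hq3 := three_le_of_nonMark (nonMark_of_rot hrq')
    obtain ⟨_, hA, hB⟩ := hdet1 q hq hrq'
    rcases hp01 with rfl | rfl
    · exact (eq_false_of_adj_oRows_eq_false hq (by omega) (by omega) hA he.symm).symm
    · exact (eq_false_of_adj_oRows_eq_false hq (by omega) (by omega) hB he.symm).symm
  rw [if_neg h3]
  -- the untouched classes: the rule is the identity
  have hopn : opnCond n O C p q = false := by
    cases h : opnCond n O C p q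
    · rfl
    · exfalso
      apply h3
      unfold opnCond at h
      simp only [Bool.or_eq_true, Bool.and_eq_true, beq_iff_eq] at h
      simp only [Bool.and_eq_true, Bool.or_eq_true, beq_iff_eq]
      rcases h with ⟨rfl, hA⟩ | ⟨rfl, hB⟩
      · exact ⟨Or.inl rfl, rot_of_opnA hA⟩
      · exact ⟨Or.inr rfl, rot_of_opnB hB⟩
  rw [hc1, hc2, hopn]
  simp

end MultiGraph

end PercRepro
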